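import Mathlib
import Literature.NumberTheory.Automorphic.ReciprocityGLnPatchingGalois
import Literature.NumberTheory.Automorphic.ReciprocityGLnPatchingFamily

/-!
# Patching over the admissible CM quadratic extensions and descent of the control to `F₀` — stub `stub_patchDescend` of line grs-explicit-descent (crux HostInducedRep, stmt-Langlands-10902)

Pure Galois theory.  Given a number field `F₀`, a prime `ℓ`, a rank `m`, a finite set `T` of
places of `F₀` and an abstract "controlled polynomial" predicate `Ctrl v P` inhabited at all but
finitely many places `v`, suppose that for every *admissible* quadratic extension `K/F₀`
(`[K:F₀] = 2`, an `F₀`-involution `cK ≠ 1`, `K` totally complex, the places above `ℓ` unramified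
over `F₀`, every `t ∈ T` split) and every auxiliary place `v₀` of `F₀` there is a continuous
semisimple `r_{K,v₀} : Γ_K → GL_m(ℚ̄_ℓ)` which is *patch-controlled* — unramified with
characteristic polynomial `P` (resp. `∏_{a ∈ roots P}(X - a²)`) at the places `u ∣ v` with
`e(u|v) = 1` and `f(u|v) = 1` (resp. `2`), for every `P` with `Ctrl v P` — at all but finitely many
places of `K` and at every place above `v₀`.  Then there is a continuous semisimple
`R : Γ_{F₀} → GL_m(ℚ̄_ℓ)` unramified with characteristic polynomial `P` at every `v` with
`Ctrl v P` (`stub_patchDescend`).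

Proof (Sorensen's patching lemma over the `∅`-general family `F₀(√-D)`, everything proved in
the tree: `Literature/NumberTheory/GaloisRepresentations/SGeneralQuadraticFamily`,
`Literature/NumberTheory/Automorphic/ReciprocityGLnPatchingGalois`):

1. Modulus `M = 8ℓ ∏_{t ∈ T} q_t`, `q_t` a rational prime below `t`; the members
   `K_D = F₀(√-D)`, `D ∈ GoodPrime F₀ M ∅` (`D` prime, `M ∣ D + 1`), with the conjugation
   `a + b√-D ↦ a - b√-D`, are admissible: totally complex, and `ℓ`, `q_t` split completely in
   `K_D` (`QuadraticFamily.ncard_primesOver_sqrtNegField_eq_two`), so `e = f = 1` above them.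
2. For every `v` some member is split at `v` (`GoodPrime.exists_split`); reading `r_{K_D,v}` at a
   place `u ∣ v` shows that the controlled polynomial at `v` is unique and is a characteristic
   polynomial, hence `P = ∏_{a ∈ roots P}(X - a)` over the algebraically closed `ℚ̄_ℓ`.
3. With the datum `E v = roots P_v`, every `r_{K_D,v₀}` is `CompatibleAE E` (patch control a.e.,
   `Ctrl` inhabited a.e., `e(u|v) = 1` a.e., `f(u|v) ∈ {1, 2}`).
4. `GoodPrime.exists_framedGaloisRep_of_compatibleAE` patches the `ρ_D = r_{K_D,v⋆}` to `R`; the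
   control above `v` is transported from `r_{K_D,v}` to `ρ_D ≅ r_{K_D,v}` (`CompatibleAE.nonempty_equiv`).

## References

* C. M. Sorensen, *A patching lemma*, in: Shimura Varieties, LMS Lecture Note Ser. 457 (2020),
  § 1, Lemma 2 and Example. [Sorensen2020]
* M. Harris, R. Taylor, *The geometry and cohomology of some simple Shimura varieties*, Ann. of
  Math. Stud. 151 (2001), proof of Thm. VII.1.9 (pp. 229–232). [HarrisTaylorAMS2001]
* M. Harris, K.-W. Lan, R. Taylor, J. Thorne, *On the rigid cohomology of certain Shimura
  varieties*, Res. Math. Sci. 3:37 (2016), proof of Cor. 7.14. [HarrisLanTaylorThorneRMS2016]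
-/

-- single-conjunct summit `Summits/Langlands/Langlands` (D-0017): the doubled namespace is the tree's layout
set_option linter.dupNamespace false

open scoped BigOperators Polynomial Classical
open Filter Set Function Polynomial IsDedekindDomain NumberField
open Literature.NumberTheory.Automorphic Literature.NumberTheory.GaloisRepresentations
open Literature.NumberTheory.GaloisRepresentations.QuadraticFamily
open Literature.NumberTheory.Automorphic.PatchingFamily

noncomputable section

namespace Summit.Langlands.Langlands.Theorems.HostInducedRep.GrsExplicitDescent

/-! ## Frobenius characteristic polynomials: uniqueness and shape -/

section Frobenius

variable {K : Type} [Field K] [NumberField K] {A : Type*} [CommRing A] [TopologicalSpace A] {m : ℕ}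

/-- Frobenius characteristic polynomials at a place of a number field are unique (a prime above
`v` exists and carries an arithmetic Frobenius). [folklore] -/
theorem hasFrobCharpolyAt_unique {v : HeightOneSpectrum (𝓞 K)} {ρ : FramedGaloisRep K A m}
    {P Q : A[X]} (hP : ρ.HasFrobCharpolyAt v P) (hQ : ρ.HasFrobCharpolyAt v Q) : P = Q := by
  obtain ⟨𝔓, h𝔓⟩ := v.primesAbove_nonempty
  obtain ⟨σ, hσ⟩ := HeightOneSpectrum.exists_isArithFrobAt_of_mem_primesAbove_holds h𝔓
  rw [← hP 𝔓 h𝔓 σ hσ, ← hQ 𝔓 h𝔓 σ hσ]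

/-- Over an algebraically closed field a Frobenius characteristic polynomial is monic and split,
hence the product of `X - a` over its roots (Mathlib `Matrix.charpoly_monic`,
`IsAlgClosed.splits`). [folklore] -/
theorem eq_prod_roots_of_hasFrobCharpolyAt {k : Type*} [Field k] [TopologicalSpace k]
    [IsAlgClosed k] {v : HeightOneSpectrum (𝓞 K)} {ρ : FramedGaloisRep K k m} {P : k[X]}
    (hP : ρ.HasFrobCharpolyAt v P) : P = (P.roots.map fun a ↦ X - C a).prod := by
  obtain ⟨𝔓, h𝔓⟩ := v.primesAbove_nonempty
  obtain ⟨σ, hσ⟩ := HeightOneSpectrum.exists_isArithFrobAt_of_mem_primesAbove_holds h𝔓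
  have hmonic : P.Monic := by
    rw [← hP 𝔓 h𝔓 σ hσ, FramedRep.charpoly]
    exact Matrix.charpoly_monic _
  exact Polynomial.Splits.eq_prod_roots_of_monic (IsAlgClosed.splits P) hmonic

end Frobenius

/-! ## Places in a quadratic (Galois) extension -/

section Places

variable {F₀ K : Type*} [Field F₀] [NumberField F₀] [Field K] [NumberField K] [Algebra F₀ K]

omit [NumberField K] in
/-- Every finite place of `F₀` lies below some finite place of `K` (Mathlib
`Ideal.exists_maximal_ideal_liesOver_of_isIntegral`). [folklore] -/
theorem exists_under_eq (v : HeightOneSpectrum (𝓞 F₀)) :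
    ∃ w : HeightOneSpectrum (𝓞 K), w.under (𝓞 F₀) = v := by
  haveI : v.asIdeal.IsMaximal := v.isMaximal
  obtain ⟨Q, hQ, hQv⟩ :=
    Ideal.exists_maximal_ideal_liesOver_of_isIntegral (S := 𝓞 K) v.asIdeal
  refine ⟨⟨Q, hQ.isPrime, ?_⟩, HeightOneSpectrum.ext hQv.over.symm⟩
  exact Ideal.ne_bot_of_liesOver_of_ne_bot v.ne_bot Q

/-- All but finitely many places of `K` are unramified over `F₀` (finitely many places of `F₀`
ramify, `finite_setOf_not_isUnramifiedIn`, and the fibres of `u ↦ u ∩ 𝓞 F₀` are finite,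
`tendsto_under_cofinite`). [folklore] -/
theorem eventually_ramificationIdx_eq_one :
    ∀ᶠ u : HeightOneSpectrum (𝓞 K) in cofinite, u.asIdeal.ramificationIdx (𝓞 F₀) = 1 := by
  have h : ∀ᶠ v : HeightOneSpectrum (𝓞 F₀) in cofinite,
      Algebra.IsUnramifiedIn (𝓞 K) v.asIdeal := by
    filter_upwards [(finite_setOf_not_isUnramifiedIn F₀ K).compl_mem_cofinite] with v hv
    simpa using hv
  filter_upwards [(tendsto_under_cofinite (𝓞 F₀)).eventually h] with u hu
  haveI : u.asIdeal.IsPrime := u.isPrime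
  exact Algebra.IsUnramifiedIn.ramificationIdx_eq_one hu ⟨rfl⟩

variable [IsGalois F₀ K]

/-- In a Galois extension, every place above a completely split `v` (`[K : F₀]` places above it)
has `e = f = 1` (`ramificationIdxIn_eq_one_of_ncard_eq_finrank`; Mathlib
`Ideal.ramificationIdxIn_eq_ramificationIdx`, `Ideal.inertiaDegIn_eq_inertiaDeg`). [folklore] -/
theorem ramificationIdx_inertiaDeg_eq_one_of_ncard (v : HeightOneSpectrum (𝓞 F₀))
    (h : (v.asIdeal.primesOver (𝓞 K)).ncard = Module.finrank F₀ K) (u : HeightOneSpectrum (𝓞 K))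
    (hu : u.under (𝓞 F₀) = v) :
    u.asIdeal.ramificationIdx (𝓞 F₀) = 1 ∧ u.asIdeal.inertiaDeg (𝓞 F₀) = 1 := by
  obtain ⟨he, hf⟩ := ramificationIdxIn_eq_one_of_ncard_eq_finrank v h
  haveI : u.asIdeal.IsPrime := u.isPrime
  haveI : u.asIdeal.LiesOver v.asIdeal := ⟨by rw [← hu]; rfl⟩
  haveI : Module.Finite (𝓞 F₀) (𝓞 K) := IsIntegralClosure.finite (𝓞 F₀) F₀ K (𝓞 K)
  haveI : IsGaloisGroup (K ≃ₐ[F₀] K) (𝓞 F₀) (𝓞 K) :=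
    IsGaloisGroup.of_isFractionRing (K ≃ₐ[F₀] K) (𝓞 F₀) (𝓞 K) F₀ K
  rw [← Ideal.ramificationIdxIn_eq_ramificationIdx v.asIdeal u.asIdeal (K ≃ₐ[F₀] K),
    ← Ideal.inertiaDegIn_eq_inertiaDeg v.asIdeal u.asIdeal (K ≃ₐ[F₀] K)]
  exact ⟨he, hf⟩

/-- In a quadratic extension every residue degree is `1` or `2` (fundamental identity
`g · e · f = 2`). [folklore] -/
theorem inertiaDeg_eq_one_or_two (h2 : Module.finrank F₀ K = 2) (u : HeightOneSpectrum (𝓞 K)) :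
    u.asIdeal.inertiaDeg (𝓞 F₀) = 1 ∨ u.asIdeal.inertiaDeg (𝓞 F₀) = 2 := by
  haveI : u.asIdeal.IsPrime := u.isPrime
  haveI : u.asIdeal.LiesOver (u.under (𝓞 F₀)).asIdeal := ⟨rfl⟩
  haveI : Module.Finite (𝓞 F₀) (𝓞 K) := IsIntegralClosure.finite (𝓞 F₀) F₀ K (𝓞 K)
  haveI : IsGaloisGroup (K ≃ₐ[F₀] K) (𝓞 F₀) (𝓞 K) :=
    IsGaloisGroup.of_isFractionRing (K ≃ₐ[F₀] K) (𝓞 F₀) (𝓞 K) F₀ K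
  have hid := Ideal.ncard_primesOver_mul_ramificationIdxIn_mul_inertiaDegIn
    (u.under (𝓞 F₀)).asIdeal (𝓞 K) (K ≃ₐ[F₀] K)
  rw [IsGalois.card_aut_eq_finrank, h2,
    Ideal.inertiaDegIn_eq_inertiaDeg (u.under (𝓞 F₀)).asIdeal u.asIdeal (K ≃ₐ[F₀] K)] at hid
  have hdvd : u.asIdeal.inertiaDeg (𝓞 F₀) ∣ 2 := Dvd.intro_left _ ((mul_assoc _ _ _).trans hid)
  exact (Nat.dvd_prime Nat.prime_two).mp hdvd

end Places

/-! ## The members `F₀(√-D)` of the patching family are admissible -/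

section Member

variable (F₀ : Type*) [Field F₀] (D : ℕ) [Fact (¬ IsSquare (-(D : F₀)))]

/-- **`F₀(√-D)` has a non-trivial `F₀`-automorphism**: the conjugation `a + b√-D ↦ a - b√-D`
(`PatchingFamily.conjRingEquiv` of the identity of `F₀`, an `F₀`-algebra map), which sends
`ω = √-D` to `-ω ≠ ω` in characteristic `0`. [folklore] -/
theorem exists_algEquiv_ne_one [CharZero F₀] :
    ∃ c : sqrtNegField F₀ D ≃ₐ[F₀] sqrtNegField F₀ D, c ≠ 1 := by
  refine ⟨AlgEquiv.ofRingEquiv (f := conjRingEquiv (RingEquiv.refl F₀)) fun a ↦ by ext <;> simp,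
    fun h ↦ ?_⟩
  have him := congrArg (fun f : sqrtNegField F₀ D ≃ₐ[F₀] sqrtNegField F₀ D ↦
    (f (QuadraticAlgebra.omega : sqrtNegField F₀ D)).im) h
  simp only [AlgEquiv.ofRingEquiv_apply, conjRingEquiv_apply_im, RingEquiv.refl_apply,
    QuadraticAlgebra.omega_im, AlgEquiv.one_apply] at him
  have h2 : (2 : F₀) = 0 := by linear_combination -him
  exact two_ne_zero h2

end Member

section Admissible

variable {F₀ : Type} [Field F₀] [NumberField F₀]

omit [NumberField F₀] in
/-- A rational integer lies in a prime of `𝓞 K` iff it lies in the prime of `𝓞 F₀` below.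
[folklore] -/
theorem natCast_mem_under_iff {K : Type*} [Field K] [Algebra F₀ K] (u : HeightOneSpectrum (𝓞 K))
    (q : ℕ) : ((q : ℕ) : 𝓞 F₀) ∈ (u.under (𝓞 F₀)).asIdeal ↔ ((q : ℕ) : 𝓞 K) ∈ u.asIdeal := by
  rw [HeightOneSpectrum.under_asIdeal, Ideal.under_def, Ideal.mem_comap, map_natCast]

/-- **The members of the family `F₀(√-D)`, `D ∈ GoodPrime F₀ M ∅`, are admissible** for `ℓ` and
`T` as soon as `8ℓ ∣ M` and `8 q_t ∣ M` for a rational prime `q_t` below each `t ∈ T`: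
`[F₀(√-D) : F₀] = 2` (`finrank_sqrtNegField`), there is a non-trivial `F₀`-automorphism
(`exists_algEquiv_ne_one`), `F₀(√-D)` is totally complex (`isTotallyComplex_sqrtNegField`), and every
place of `F₀` above `ℓ` or in `T` splits completely in `F₀(√-D)`
(`ncard_primesOver_sqrtNegField_eq_two`: `-D` is a square in `F₀,v` as `8q ∣ D + 1`), so the
places above have `e = f = 1`. [cite: Sorensen2020, §1 Example] -/
theorem admissible_member (ℓ : ℕ) [Fact ℓ.Prime] (T : Finset (HeightOneSpectrum (𝓞 F₀)))
    {M : ℕ} (hℓM : 8 * ℓ ∣ M)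
    (hTM : ∀ t ∈ T, ∃ q : ℕ, q.Prime ∧ ((q : ℕ) : 𝓞 F₀) ∈ t.asIdeal ∧ 8 * q ∣ M)
    (i : GoodPrime F₀ M ∅) :
    ∃ cK : sqrtNegField F₀ i.1 ≃ₐ[F₀] sqrtNegField F₀ i.1,
      Module.finrank F₀ (sqrtNegField F₀ i.1) = 2 ∧ cK ≠ 1 ∧ IsTotallyComplex (sqrtNegField F₀ i.1) ∧
      (∀ u : HeightOneSpectrum (𝓞 (sqrtNegField F₀ i.1)),
        ((ℓ : ℕ) : 𝓞 (sqrtNegField F₀ i.1)) ∈ u.asIdeal →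
          u.asIdeal.ramificationIdx (𝓞 F₀) = 1) ∧
      (∀ t ∈ T, ∀ u : HeightOneSpectrum (𝓞 (sqrtNegField F₀ i.1)), u.under (𝓞 F₀) = t →
        u.asIdeal.ramificationIdx (𝓞 F₀) = 1 ∧ u.asIdeal.inertiaDeg (𝓞 F₀) = 1) := by
  have hMD : M ∣ i.1 + 1 := i.2.2.1
  have hsplit : ∀ (v : HeightOneSpectrum (𝓞 F₀)) (q : ℕ), q.Prime → ((q : ℕ) : 𝓞 F₀) ∈ v.asIdeal →
      8 * q ∣ M → ∀ u : HeightOneSpectrum (𝓞 (sqrtNegField F₀ i.1)), u.under (𝓞 F₀) = v →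
        u.asIdeal.ramificationIdx (𝓞 F₀) = 1 ∧ u.asIdeal.inertiaDeg (𝓞 F₀) = 1 := by
    intro v q hq hqv hqM u hu
    refine ramificationIdx_inertiaDeg_eq_one_of_ncard v ?_ u hu
    rw [finrank_sqrtNegField]
    exact ncard_primesOver_sqrtNegField_eq_two v hq hqv (hqM.trans hMD)
  obtain ⟨cK, hcK⟩ := exists_algEquiv_ne_one F₀ i.1
  refine ⟨cK, finrank_sqrtNegField, hcK, isTotallyComplex_sqrtNegField i.ne_zero,
    fun u hu ↦ ?_, fun t ht u hu ↦ ?_⟩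
  · exact (hsplit (u.under (𝓞 F₀)) ℓ Fact.out ((natCast_mem_under_iff u ℓ).mpr hu) hℓM u rfl).1
  · obtain ⟨q, hq, hqt, hqM⟩ := hTM t ht
    exact hsplit t q hq hqt hqM u hu

end Admissible

/-! ## Almost-everywhere compatibility of a patch-controlled representation -/

section Compatible

variable {F₀ : Type} [Field F₀] [NumberField F₀] {K : Type} [Field K] [NumberField K]
  [Algebra F₀ K] [IsGalois F₀ K] {ℓ : ℕ} [Fact ℓ.Prime] {m : ℕ}

/-- **Patch control almost everywhere gives `CompatibleAE`.**  Let `[K : F₀] = 2`, `Ctrl` be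
inhabited at all but finitely many places of `F₀`, `E v = roots P` for every controlled `P` at
`v`, and controlled polynomials be products of `X - a` over their roots.  If `r : Γ_K → GL_m` is
patch-controlled at all but finitely many places `u` of `K`, then `r` is unramified with
characteristic polynomial `frobPoly E v f(u|v)` at all but finitely many `u` (the three cofinite
conditions: control, `Ctrl` inhabited below `u`, `e(u|v) = 1`; and `f(u|v) ∈ {1, 2}`).
[folklore] -/
theorem compatibleAE_of_ctrl (h2 : Module.finrank F₀ K = 2)
    {Ctrl : HeightOneSpectrum (𝓞 F₀) → (PadicAlgCl ℓ)[X] → Prop}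
    (hcof : ∀ᶠ v : HeightOneSpectrum (𝓞 F₀) in cofinite, ∃ P, Ctrl v P)
    {E : HeightOneSpectrum (𝓞 F₀) → Multiset (PadicAlgCl ℓ)}
    (hEv : ∀ (v : HeightOneSpectrum (𝓞 F₀)) (P : (PadicAlgCl ℓ)[X]), Ctrl v P → E v = P.roots)
    (hshape : ∀ (v : HeightOneSpectrum (𝓞 F₀)) (P : (PadicAlgCl ℓ)[X]), Ctrl v P →
      P = (P.roots.map fun a ↦ X - C a).prod)
    {r : FramedGaloisRep K (PadicAlgCl ℓ) m}
    (hr : ∀ᶠ u : HeightOneSpectrum (𝓞 K) in cofinite,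
      ∀ P : (PadicAlgCl ℓ)[X], Ctrl (u.under (𝓞 F₀)) P → u.asIdeal.ramificationIdx (𝓞 F₀) = 1 →
        r.IsUnramifiedAt u ∧ (u.asIdeal.inertiaDeg (𝓞 F₀) = 1 → r.HasFrobCharpolyAt u P) ∧
          (u.asIdeal.inertiaDeg (𝓞 F₀) = 2 →
            r.HasFrobCharpolyAt u (P.roots.map fun a ↦ X - C (a ^ 2)).prod)) :
    CompatibleAE E r := by
  have h₂ : ∀ᶠ u : HeightOneSpectrum (𝓞 K) in cofinite, ∃ P, Ctrl (u.under (𝓞 F₀)) P :=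
    (tendsto_under_cofinite (𝓞 F₀)).eventually hcof
  have h₃ : ∀ᶠ u : HeightOneSpectrum (𝓞 K) in cofinite, u.asIdeal.ramificationIdx (𝓞 F₀) = 1 :=
    eventually_ramificationIdx_eq_one
  show ∀ᶠ u : HeightOneSpectrum (𝓞 K) in cofinite, _
  filter_upwards [hr, h₂, h₃] with u hu hP he
  obtain ⟨P, hP⟩ := hP
  obtain ⟨hunr, hf1, hf2⟩ := hu P hP he
  refine ⟨hunr, ?_⟩
  rcases inertiaDeg_eq_one_or_two h2 u with hf | hf
  · rw [hf, frobPoly_one, hEv _ P hP, ← hshape _ P hP]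
    exact hf1 hf
  · rw [hf]
    show r.HasFrobCharpolyAt u (((E (u.under (𝓞 F₀))).map fun a ↦ X - C (a ^ 2)).prod)
    rw [hEv _ P hP]
    exact hf2 hf

end Compatible

/-! ## The stub -/

/-- **Stub S5 — patching over the CM quadratic extensions of `F₀` split at `T` and above `ℓ`, and
descent of the control to `F₀` (pure Galois theory + Dirichlet).**  Let `F₀` be a number field,
`ℓ` a prime, `m` a rank, `T` a finite set of places of `F₀`, and `Ctrl v P` an abstract
"controlled polynomial at `v`" predicate such that all but finitely many `v` carry a controlled
polynomial.  Suppose that for every admissible `K` (quadratic, totally complex, involution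
`cK ≠ 1`, places above `ℓ` unramified over `F₀`, every `t ∈ T` split) and every place `v₀` of `F₀`
there is a continuous semisimple `r_{K,v₀} : Γ_K → GL_m(ℚ̄_ℓ)` with patch control (unramified with
characteristic polynomial `P`, resp. `∏_{a ∈ roots P}(X - a²)`, at the places `u` with
`e(u∣v) = 1` and `f(u∣v) = 1`, resp. `2`, above a place `v` with `Ctrl v P`) at all but finitely
many places of `K` and at every place above `v₀`.  Then there is a continuous semisimple
`R : Γ_{F₀} → GL_m(ℚ̄_ℓ)` unramified with characteristic polynomial `P` at every `v` with
`Ctrl v P`.  Proof: module docstring (the admissible `∅`-general family `F₀(√-D)`,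
`D ∈ GoodPrime F₀ (8ℓ∏q_t) ∅`; `GoodPrime.exists_framedGaloisRep_of_compatibleAE`; read-off through
the member split at `v`).  References: Sorensen, *A patching lemma* §1 Lemma 2 and Example;
Harris–Taylor, proof of Thm VII.1.9; Harris–Lan–Taylor–Thorne, proof of Cor 7.14. -/
theorem stub_patchDescend :
    ∀ (F₀ : Type) [Field F₀] [NumberField F₀] (ℓ : ℕ) [Fact ℓ.Prime] (m : ℕ)
      (T : Finset (HeightOneSpectrum (𝓞 F₀)))
      (Ctrl : HeightOneSpectrum (𝓞 F₀) → (PadicAlgCl ℓ)[X] → Prop),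
      (∀ᶠ v : HeightOneSpectrum (𝓞 F₀) in cofinite, ∃ P, Ctrl v P) →
      (∀ (K : Type) [Field K] [NumberField K] [Algebra F₀ K] (cK : K ≃ₐ[F₀] K),
        (Module.finrank F₀ K = 2 ∧ cK ≠ 1 ∧ IsTotallyComplex K ∧
          (∀ u : HeightOneSpectrum (𝓞 K), ((ℓ : ℕ) : 𝓞 K) ∈ u.asIdeal →
            u.asIdeal.ramificationIdx (𝓞 F₀) = 1) ∧
          (∀ t ∈ T, ∀ u : HeightOneSpectrum (𝓞 K), u.under (𝓞 F₀) = t →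
            u.asIdeal.ramificationIdx (𝓞 F₀) = 1 ∧ u.asIdeal.inertiaDeg (𝓞 F₀) = 1)) →
        ∀ v₀ : HeightOneSpectrum (𝓞 F₀), ∃ r : FramedGaloisRep K (PadicAlgCl ℓ) m,
          r.toGaloisRep.IsSemisimple ∧
          (∀ᶠ u : HeightOneSpectrum (𝓞 K) in cofinite,
            ∀ P : (PadicAlgCl ℓ)[X], Ctrl (u.under (𝓞 F₀)) P → u.asIdeal.ramificationIdx (𝓞 F₀) = 1 →
              r.IsUnramifiedAt u ∧ (u.asIdeal.inertiaDeg (𝓞 F₀) = 1 → r.HasFrobCharpolyAt u P) ∧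
                (u.asIdeal.inertiaDeg (𝓞 F₀) = 2 →
                  r.HasFrobCharpolyAt u (P.roots.map fun a ↦ X - C (a ^ 2)).prod)) ∧
          ∀ u : HeightOneSpectrum (𝓞 K), u.under (𝓞 F₀) = v₀ →
            ∀ P : (PadicAlgCl ℓ)[X], Ctrl (u.under (𝓞 F₀)) P → u.asIdeal.ramificationIdx (𝓞 F₀) = 1 →
              r.IsUnramifiedAt u ∧ (u.asIdeal.inertiaDeg (𝓞 F₀) = 1 → r.HasFrobCharpolyAt u P) ∧
                (u.asIdeal.inertiaDeg (𝓞 F₀) = 2 →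
                  r.HasFrobCharpolyAt u (P.roots.map fun a ↦ X - C (a ^ 2)).prod)) →
      ∃ R : FramedGaloisRep F₀ (PadicAlgCl ℓ) m, R.toGaloisRep.IsSemisimple ∧
        ∀ (v : HeightOneSpectrum (𝓞 F₀)) (P : (PadicAlgCl ℓ)[X]), Ctrl v P →
          R.IsUnramifiedAt v ∧ R.HasFrobCharpolyAt v P := by
  intro F₀ _ _ ℓ _ m T Ctrl hcof hK
  have hℓ : ℓ.Prime := Fact.out
  -- Step 1: the modulus `M = 8ℓ ∏_{t ∈ T} q_t`
  choose q hq hqmem using fun v : HeightOneSpectrum (𝓞 F₀) ↦ exists_prime_natCast_mem v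
  obtain ⟨M, hM0, hℓM, hTM⟩ : ∃ M : ℕ, M ≠ 0 ∧ 8 * ℓ ∣ M ∧
      ∀ t ∈ T, ∃ q : ℕ, q.Prime ∧ ((q : ℕ) : 𝓞 F₀) ∈ t.asIdeal ∧ 8 * q ∣ M := by
    refine ⟨8 * ℓ * ∏ t ∈ T, q t, ?_, Dvd.intro _ rfl, fun t ht ↦ ⟨q t, hq t, hqmem t, ?_⟩⟩
    · exact mul_ne_zero (mul_ne_zero (by norm_num) hℓ.ne_zero)
        (Finset.prod_ne_zero_iff.mpr fun t _ ↦ (hq t).ne_zero)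
    · rw [mul_assoc]
      exact mul_dvd_mul_left 8 ((Finset.dvd_prod_of_mem q ht).mul_left ℓ)
  -- Step 2: the representations `r i v₀` over the admissible members `F₀(√-D_i)`
  choose cK hadm using fun i : GoodPrime F₀ M ∅ ↦ admissible_member ℓ T hℓM hTM i
  choose r hrss hrae hrv using fun (i : GoodPrime F₀ M ∅) (v₀ : HeightOneSpectrum (𝓞 F₀)) ↦
    hK (sqrtNegField F₀ i.1) (cK i) (hadm i) v₀
  -- every place of `F₀` splits completely in some member, and has a place above it
  have hsplit : ∀ v : HeightOneSpectrum (𝓞 F₀), ∃ i : GoodPrime F₀ M ∅,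
      (v.asIdeal.primesOver (𝓞 (sqrtNegField F₀ i.1))).ncard = 2 := fun v ↦ by
    obtain ⟨i, hi⟩ := GoodPrime.exists_split F₀ M ∅ hM0 Set.finite_empty v
    exact ⟨i, by rwa [finrank_sqrtNegField] at hi⟩
  have hef : ∀ (v : HeightOneSpectrum (𝓞 F₀)) (i : GoodPrime F₀ M ∅),
      (v.asIdeal.primesOver (𝓞 (sqrtNegField F₀ i.1))).ncard = 2 →
      ∀ u : HeightOneSpectrum (𝓞 (sqrtNegField F₀ i.1)), u.under (𝓞 F₀) = v →
        u.asIdeal.ramificationIdx (𝓞 F₀) = 1 ∧ u.asIdeal.inertiaDeg (𝓞 F₀) = 1 :=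
    fun v i hi u hu ↦ ramificationIdx_inertiaDeg_eq_one_of_ncard v
      (hi.trans finrank_sqrtNegField.symm) u hu
  -- control of `r i v` above `v` in a member split at `v`
  have hctrl : ∀ (v : HeightOneSpectrum (𝓞 F₀)) (i : GoodPrime F₀ M ∅),
      (v.asIdeal.primesOver (𝓞 (sqrtNegField F₀ i.1))).ncard = 2 →
      ∀ u : HeightOneSpectrum (𝓞 (sqrtNegField F₀ i.1)), u.under (𝓞 F₀) = v →
        ∀ P, Ctrl v P → (r i v).IsUnramifiedAt u ∧ (r i v).HasFrobCharpolyAt u P := by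
    intro v i hi u hu P hP
    obtain ⟨he, hf⟩ := hef v i hi u hu
    obtain ⟨hunr, hf1, -⟩ := hrv i v u hu P (by rw [hu]; exact hP) he
    exact ⟨hunr, hf1 hf⟩
  -- Step 3: controlled polynomials are unique and are products over their roots
  have hAt : ∀ v : HeightOneSpectrum (𝓞 F₀), ∃ (i : GoodPrime F₀ M ∅)
      (u : HeightOneSpectrum (𝓞 (sqrtNegField F₀ i.1))),
        ∀ P, Ctrl v P → (r i v).HasFrobCharpolyAt u P := by
    intro v
    obtain ⟨i, hi⟩ := hsplit v
    obtain ⟨u, hu⟩ := exists_under_eq (K := sqrtNegField F₀ i.1) v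
    exact ⟨i, u, fun P hP ↦ (hctrl v i hi u hu P hP).2⟩
  have huniq : ∀ (v : HeightOneSpectrum (𝓞 F₀)) (P P' : (PadicAlgCl ℓ)[X]),
      Ctrl v P → Ctrl v P' → P = P' := by
    intro v P P' hP hP'
    obtain ⟨i, u, h⟩ := hAt v
    exact hasFrobCharpolyAt_unique (h P hP) (h P' hP')
  have hshape : ∀ (v : HeightOneSpectrum (𝓞 F₀)) (P : (PadicAlgCl ℓ)[X]), Ctrl v P →
      P = (P.roots.map fun a ↦ X - C a).prod := by
    intro v P hP
    obtain ⟨i, u, h⟩ := hAt v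
    exact eq_prod_roots_of_hasFrobCharpolyAt (h P hP)
  -- Step 4: the Frobenius datum `E v = roots P_v`
  obtain ⟨E, hEv⟩ : ∃ E : HeightOneSpectrum (𝓞 F₀) → Multiset (PadicAlgCl ℓ),
      ∀ (v : HeightOneSpectrum (𝓞 F₀)) (P : (PadicAlgCl ℓ)[X]), Ctrl v P → E v = P.roots := by
    refine ⟨fun v ↦ if h : ∃ P, Ctrl v P then h.choose.roots else 0, fun v P hP ↦ ?_⟩
    have h : ∃ P, Ctrl v P := ⟨P, hP⟩
    simp only [dif_pos h]
    rw [huniq v _ P h.choose_spec hP]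
  -- Step 5: every `r i v₀` is compatible almost everywhere with `E`
  have hcomp : ∀ (i : GoodPrime F₀ M ∅) (v₀ : HeightOneSpectrum (𝓞 F₀)),
      CompatibleAE E (r i v₀) := fun i v₀ ↦
    compatibleAE_of_ctrl finrank_sqrtNegField hcof hEv hshape (hrae i v₀)
  -- Step 6: patch the `ρ i := r i v⋆`
  haveI := SorensenPatching.infinite_heightOneSpectrum F₀
  obtain ⟨vs⟩ := (inferInstance : Nonempty (HeightOneSpectrum (𝓞 F₀)))
  obtain ⟨R, hRss, -, hRT⟩ := GoodPrime.exists_framedGaloisRep_of_compatibleAE (K := F₀)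
    (m := M) (B := ∅) hM0 Set.finite_empty E (fun i ↦ r i vs) (fun i ↦ hrss i vs)
    (fun i ↦ hcomp i vs) {v | ∃ P, Ctrl v P} (by
      rintro v ⟨P, hP⟩
      obtain ⟨i, hi⟩ := hsplit v
      refine ⟨i, hi, fun w hw ↦ ?_⟩
      have hw' : w.under (𝓞 F₀) = v := HeightOneSpectrum.ext hw
      obtain ⟨hunr, hch⟩ := hctrl v i hi w hw' P hP
      obtain ⟨e⟩ := (hcomp i v).nonempty_equiv (hrss i v) (hrss i vs) (hcomp i vs)
      refine ⟨FramedGaloisRep.isUnramifiedAt_of_equiv e hunr, ?_⟩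
      rw [hEv v P hP, ← hshape v P hP]
      exact FramedGaloisRep.hasFrobCharpolyAt_of_equiv e hch)
  refine ⟨R, hRss, fun v P hP ↦ ?_⟩
  obtain ⟨hunr, hch⟩ := hRT v ⟨P, hP⟩
  rw [hEv v P hP, ← hshape v P hP] at hch
  exact ⟨hunr, hch⟩

end Summit.Langlands.Langlands.Theorems.HostInducedRep.GrsExplicitDescent

end
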